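import Literature.AlgebraicGeometry.Deformation.LiftedTransitions
import HarnessLib

/-!
# Change of frames for lifted transition matrices: invertible lifts and the transformed defect

Continuation of `Deformation/LiftedTransitions.lean`. Let `i : Z₀ ⟶ Z₁` be a first-order
thickening, `F` an `𝒪_{Z₀}`-module with a frame cover `C = (U_a, I_a, e_a)` and a system of lifts
`T̃` with defect `c`. Given OTHER frames `e'_a : 𝒪^{I'_a} ≅ F|_{i⁻¹U_a}` over the same opens
(`FrameCover.reframe`), the transition matrices change by `T'_{ab} = u'_a T_{ab} u_b` with the
change-of-frame matrices `u_a = T(e_a, e'_a)`, `u'_a = T(e'_a, e_a) = u_a⁻¹` (`trans_reframe`).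

* `exists_inverse_lift` — **over a first-order thickening, lifts of mutually inverse matrices can be
  chosen mutually inverse**: if `A` lifts `u` and `B` lifts `u'` with `u u' = 1 = u' u`, then
  `B (1 - N)`, `N = AB - 1` (`N² = 0`), is a two-sided inverse of `A` lifting `u'`;
* `LiftedFrameChange` — mutually inverse lifts `ũ_a`, `ũ'_a` of `u_a`, `u'_a` (they exist when the
  `U_a` are affine, `nonempty_liftedFrameChange`);
* `Lifts.reframe` — the transformed lifts `T̃'_{ab} = ũ'_a T̃_{ab} ũ_b` for the new frames, and
  **`defect_reframe`: their defect is `c'_{abd} = ũ'_a c_{abd} ũ_d`** (exactly, since `ũ_b ũ'_b = 1`).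

This is the frame-independence input for the obstruction cochain of `F` (Hartshorne,
*Deformation Theory*, proof of Thm. 7.1: "a different choice of bases changes the cocycle by
conjugation"). Everything is proved; no named facts.

## References

* R. Hartshorne, *Deformation Theory*, GTM 257 (2010), §7, proof of Thm. 7.1. [Hartshorne2010]
* The Stacks Project, Tag 08KY. [StacksProject]
-/

noncomputable section

open CategoryTheory AlgebraicGeometry Opposite TopologicalSpace Limits

namespace Literature.AlgebraicGeometry.Deformation

open Literature.AlgebraicGeometry.Modules Literature.AlgebraicGeometry.Motives

universe u

variable {Z₀ Z₁ : Scheme.{u}} (i : Z₀ ⟶ Z₁)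

/-! ### Invertible lifts of invertible matrices -/

section InverseLift

variable [IsFirstOrderThickening i] {W : Z₁.Opens} {m n : Type*} [Fintype m] [Fintype n]
  [DecidableEq m] [DecidableEq n]

/-- **Over a first-order thickening, an inverse pair of matrices lifts to an inverse pair**: if `A`
lifts `u` and `B` lifts `u'` with `u u' = 1`, `u' u = 1`, then `B' = B (1 - N)`, `N = A B - 1`, lifts
`u'` and satisfies `A B' = 1`, `B' A = 1` (`N`, `N' = B A - 1` are killed by `i♯`, so `N² = N'² = 0`,
`A B' = (1 + N)(1 - N) = 1`, and the left inverse `(1 - N') B` coincides with the right inverse).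
[cite: StacksProject, Tag 08KY] -/
theorem exists_inverse_lift (u : Matrix m n Γ(Z₀, i ⁻¹ᵁ W)) (u' : Matrix n m Γ(Z₀, i ⁻¹ᵁ W))
    (huu' : u * u' = 1) (hu'u : u' * u = 1) (A : Matrix m n Γ(Z₁, W)) (B : Matrix n m Γ(Z₁, W))
    (hA : A.map (i.app W).hom = u) (hB : B.map (i.app W).hom = u') :
    ∃ B' : Matrix n m Γ(Z₁, W), B'.map (i.app W).hom = u' ∧ A * B' = 1 ∧ B' * A = 1 := by
  obtain ⟨N, hN⟩ : ∃ N, A * B = 1 + N := ⟨_, (add_sub_cancel 1 (A * B)).symm⟩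
  obtain ⟨N', hN'⟩ : ∃ N', B * A = 1 + N' := ⟨_, (add_sub_cancel 1 (B * A)).symm⟩
  have hmapN : N.map (i.app W).hom = 0 := by
    rw [show N = A * B - 1 by rw [hN, add_sub_cancel_left], Matrix.map_sub _ (map_sub _), Matrix.map_mul,
      hA, hB, huu', Matrix.map_one _ (map_zero _) (map_one _), sub_self]
  have hmapN' : N'.map (i.app W).hom = 0 := by
    rw [show N' = B * A - 1 by rw [hN', add_sub_cancel_left], Matrix.map_sub _ (map_sub _), Matrix.map_mul,
      hA, hB, hu'u, Matrix.map_one _ (map_zero _) (map_one _), sub_self]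
  have hNN : N * N = 0 := matrix_mul_eq_zero_of_map_eq_zero i N N hmapN hmapN
  have hN'N' : N' * N' = 0 := matrix_mul_eq_zero_of_map_eq_zero i N' N' hmapN' hmapN'
  -- right inverse `R = B (1 - N)`, left inverse `L = (1 - N') B`
  have hR : A * (B * (1 - N)) = 1 := by
    rw [← Matrix.mul_assoc, hN, Matrix.add_mul, Matrix.one_mul, Matrix.mul_sub, Matrix.mul_one, hNN,
      sub_zero, sub_add_cancel]
  have hL : (1 - N') * B * A = 1 := by
    rw [Matrix.mul_assoc, hN', Matrix.mul_add, Matrix.mul_one, Matrix.sub_mul, Matrix.one_mul, hN'N',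
      sub_zero, sub_add_cancel]
  have hLR : (1 - N') * B = B * (1 - N) := by
    calc (1 - N') * B = (1 - N') * B * (A * (B * (1 - N))) := by rw [hR, Matrix.mul_one]
      _ = (1 - N') * B * A * (B * (1 - N)) := by simp only [Matrix.mul_assoc]
      _ = B * (1 - N) := by rw [hL, Matrix.one_mul]
  refine ⟨B * (1 - N), ?_, hR, ?_⟩
  · rw [Matrix.map_mul, hB, Matrix.map_sub _ (map_sub _), Matrix.map_one _ (map_zero _) (map_one _),
      hmapN, sub_zero, Matrix.mul_one]
  · rw [← hLR, hL]

end InverseLift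

/-! ### Reframing a frame cover -/

variable {i} {F : Z₀.Modules} {ι : Type u}

namespace FrameCover

variable (C : FrameCover i F ι) {I' : ι → Type u} (e' : ∀ a, SheafOfModules.free (I' a) ≅ F.over (i ⁻¹ᵁ (C.U a)))

/-- The frame cover with the same opens and the new frames `e'_a` (reducible, so that its opens and
index types are those of `C` and `I'` syntactically). [folklore] -/
abbrev reframe [∀ a, Fintype (I' a)] [∀ a, DecidableEq (I' a)] : FrameCover i F ι where
  U := C.U
  I := I'
  e := e'

/-- **The change-of-frame matrix `u_a = T(e_a, e'_a)`** over `i⁻¹V`, `V ≤ U_a`. [folklore] -/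
def cof (a : ι) (V : Z₁.Opens) (ha : V ≤ C.U a) : Matrix (C.I a) (I' a) Γ(Z₀, i ⁻¹ᵁ V) :=
  transition (C.e a) (e' a) (C.incl ha) (C.incl ha)

/-- **The inverse change-of-frame matrix `u'_a = T(e'_a, e_a)`.** [folklore] -/
def cof' (a : ι) (V : Z₁.Opens) (ha : V ≤ C.U a) : Matrix (I' a) (C.I a) Γ(Z₀, i ⁻¹ᵁ V) :=
  transition (e' a) (C.e a) (C.incl ha) (C.incl ha)

/-- `u_a u'_a = 1`. [folklore] -/
lemma cof_mul_cof' [∀ a, Fintype (I' a)] (a : ι) (V : Z₁.Opens) (ha : V ≤ C.U a) : C.cof e' a V ha * C.cof' e' a V ha = 1 :=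
  transition_mul_symm _ _ _ _

/-- `u'_a u_a = 1`. [folklore] -/
lemma cof'_mul_cof [∀ a, Fintype (I' a)] [∀ a, DecidableEq (I' a)] (a : ι) (V : Z₁.Opens) (ha : V ≤ C.U a) : C.cof' e' a V ha * C.cof e' a V ha = 1 :=
  transition_mul_symm _ _ _ _

/-- `u_a` is compatible with restriction. [folklore] -/
lemma cof_map (a : ι) {V V' : Z₁.Opens} (ha : V ≤ C.U a) (h : V' ≤ V) :
    (C.cof e' a V ha).map (secRes Z₀ ((Opens.map i.base).map (homOfLE h)).le) =
      C.cof e' a V' (h.trans ha) :=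
  transition_map (C.e a) (e' a) (C.incl ha) (C.incl ha) ((Opens.map i.base).map (homOfLE h))

/-- `u'_a` is compatible with restriction. [folklore] -/
lemma cof'_map (a : ι) {V V' : Z₁.Opens} (ha : V ≤ C.U a) (h : V' ≤ V) :
    (C.cof' e' a V ha).map (secRes Z₀ ((Opens.map i.base).map (homOfLE h)).le) =
      C.cof' e' a V' (h.trans ha) :=
  transition_map (e' a) (C.e a) (C.incl ha) (C.incl ha) ((Opens.map i.base).map (homOfLE h))

/-- **Transition matrices after reframing**: `T'_{ab} = u'_a T_{ab} u_b`.
[cite: Hartshorne1977, II.5 (p. 109)] -/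
theorem trans_reframe [∀ a, Fintype (I' a)] [∀ a, DecidableEq (I' a)] (a b : ι) (V : Z₁.Opens) (ha : V ≤ C.U a) (hb : V ≤ C.U b) :
    (C.reframe e').trans a b V ha hb = C.cof' e' a V ha * C.trans a b V ha hb * C.cof e' b V hb := by
  rw [trans, cof', trans, cof, transition_mul, transition_mul]

/-- **Mutually inverse lifts of the change-of-frame matrices**: `ũ_a`, `ũ'_a` over `U_a ⊆ Z₁` with
`i♯ ũ_a = u_a`, `i♯ ũ'_a = u'_a`, `ũ_a ũ'_a = 1`, `ũ'_a ũ_a = 1`. [folklore] -/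
structure LiftedFrameChange [∀ a, Fintype (I' a)] [∀ a, DecidableEq (I' a)] where
  /-- The lift `ũ_a` of `u_a`. -/
  V : ∀ a, Matrix (C.I a) (I' a) Γ(Z₁, C.U a)
  /-- The lift `ũ'_a` of `u'_a`. -/
  V' : ∀ a, Matrix (I' a) (C.I a) Γ(Z₁, C.U a)
  /-- `i♯ ũ_a = u_a`. -/
  map_V : ∀ a, (V a).map (i.app (C.U a)).hom = C.cof e' a (C.U a) le_rfl
  /-- `i♯ ũ'_a = u'_a`. -/
  map_V' : ∀ a, (V' a).map (i.app (C.U a)).hom = C.cof' e' a (C.U a) le_rfl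
  /-- `ũ_a ũ'_a = 1`. -/
  V_mul_V' : ∀ a, V a * V' a = 1
  /-- `ũ'_a ũ_a = 1`. -/
  V'_mul_V : ∀ a, V' a * V a = 1

/-- **Mutually inverse lifts of the change-of-frame matrices exist on a first-order thickening
when the `U_a` are affine** (lift both matrices entrywise, `Scheme.Hom.app_surjective`, then correct
by `exists_inverse_lift`). [cite: StacksProject, Tag 08KY] -/
theorem nonempty_liftedFrameChange [∀ a, Fintype (I' a)] [∀ a, DecidableEq (I' a)]
    [IsFirstOrderThickening i] (hU : ∀ a, IsAffineOpen (C.U a)) :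
    Nonempty (C.LiftedFrameChange e') := by
  have key : ∀ a, ∃ (A : Matrix (C.I a) (I' a) Γ(Z₁, C.U a)) (B' : Matrix (I' a) (C.I a) Γ(Z₁, C.U a)),
      A.map (i.app (C.U a)).hom = C.cof e' a (C.U a) le_rfl ∧
        B'.map (i.app (C.U a)).hom = C.cof' e' a (C.U a) le_rfl ∧ A * B' = 1 ∧ B' * A = 1 := by
    intro a
    have hs := i.app_surjective (C.U a) (hU a)
    let A : Matrix (C.I a) (I' a) Γ(Z₁, C.U a) :=
      Matrix.of fun j k => Function.surjInv hs (C.cof e' a (C.U a) le_rfl j k)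
    let B : Matrix (I' a) (C.I a) Γ(Z₁, C.U a) :=
      Matrix.of fun j k => Function.surjInv hs (C.cof' e' a (C.U a) le_rfl j k)
    have hA : A.map (i.app (C.U a)).hom = C.cof e' a (C.U a) le_rfl := by
      ext j k; exact Function.surjInv_eq hs _
    have hB : B.map (i.app (C.U a)).hom = C.cof' e' a (C.U a) le_rfl := by
      ext j k; exact Function.surjInv_eq hs _
    obtain ⟨B', hB', h1, h2⟩ := exists_inverse_lift i _ _ (C.cof_mul_cof' e' a _ le_rfl)
      (C.cof'_mul_cof e' a _ le_rfl) A B hA hB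
    exact ⟨A, B', hA, hB', h1, h2⟩
  choose A B' hA hB' h1 h2 using key
  exact ⟨⟨A, B', hA, hB', h1, h2⟩⟩

namespace LiftedFrameChange

variable {C e'} [∀ a, Fintype (I' a)] [∀ a, DecidableEq (I' a)] (Φ : C.LiftedFrameChange e')

/-- `ũ_a` restricted to `V ≤ U_a`. [folklore] -/
def VOn (a : ι) (V : Z₁.Opens) (ha : V ≤ C.U a) : Matrix (C.I a) (I' a) Γ(Z₁, V) :=
  (Φ.V a).map (secRes Z₁ ha)

/-- `ũ'_a` restricted to `V ≤ U_a`. [folklore] -/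
def V'On (a : ι) (V : Z₁.Opens) (ha : V ≤ C.U a) : Matrix (I' a) (C.I a) Γ(Z₁, V) :=
  (Φ.V' a).map (secRes Z₁ ha)

/-- `ũ_a ũ'_a = 1` over `V`. [folklore] -/
lemma VOn_mul_V'On (a : ι) (V : Z₁.Opens) (ha : V ≤ C.U a) : Φ.VOn a V ha * Φ.V'On a V ha = 1 := by
  rw [VOn, V'On, ← Matrix.map_mul, Φ.V_mul_V', Matrix.map_one _ (map_zero _) (map_one _)]

/-- `ũ'_a ũ_a = 1` over `V`. [folklore] -/
lemma V'On_mul_VOn (a : ι) (V : Z₁.Opens) (ha : V ≤ C.U a) : Φ.V'On a V ha * Φ.VOn a V ha = 1 := by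
  rw [VOn, V'On, ← Matrix.map_mul, Φ.V'_mul_V, Matrix.map_one _ (map_zero _) (map_one _)]

/-- `ũ_a|_V` is compatible with restriction. [folklore] -/
lemma VOn_map (a : ι) {V V' : Z₁.Opens} (ha : V ≤ C.U a) (h : V' ≤ V) :
    (Φ.VOn a V ha).map (secRes Z₁ h) = Φ.VOn a V' (h.trans ha) := by
  rw [VOn, VOn, Matrix.map_map]
  congr 1; funext x; exact secRes_secRes _ _ _

/-- `ũ'_a|_V` is compatible with restriction. [folklore] -/
lemma V'On_map (a : ι) {V V' : Z₁.Opens} (ha : V ≤ C.U a) (h : V' ≤ V) :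
    (Φ.V'On a V ha).map (secRes Z₁ h) = Φ.V'On a V' (h.trans ha) := by
  rw [V'On, V'On, Matrix.map_map]
  congr 1; funext x; exact secRes_secRes _ _ _

/-- `i♯ (ũ_a|_V) = u_a|_{i⁻¹V}`. [folklore] -/
lemma map_VOn (a : ι) (V : Z₁.Opens) (ha : V ≤ C.U a) :
    (Φ.VOn a V ha).map (i.app V).hom = C.cof e' a V ha := by
  rw [VOn, Matrix.map_map]
  have h : ((i.app V).hom ∘ (secRes Z₁ ha)) =
      (secRes Z₀ ((Opens.map i.base).map (homOfLE ha)).le) ∘ (i.app (C.U a)).hom := by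
    funext x; exact app_secRes i ha x
  rw [h, ← Matrix.map_map, Φ.map_V, C.cof_map e' a le_rfl ha]

/-- `i♯ (ũ'_a|_V) = u'_a|_{i⁻¹V}`. [folklore] -/
lemma map_V'On (a : ι) (V : Z₁.Opens) (ha : V ≤ C.U a) :
    (Φ.V'On a V ha).map (i.app V).hom = C.cof' e' a V ha := by
  rw [V'On, Matrix.map_map]
  have h : ((i.app V).hom ∘ (secRes Z₁ ha)) =
      (secRes Z₀ ((Opens.map i.base).map (homOfLE ha)).le) ∘ (i.app (C.U a)).hom := by
    funext x; exact app_secRes i ha x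
  rw [h, ← Matrix.map_map, Φ.map_V', C.cof'_map e' a le_rfl ha]

end LiftedFrameChange

/-! ### The transformed system of lifts and its defect -/

namespace Lifts

variable {C e'} [∀ a, Fintype (I' a)] [∀ a, DecidableEq (I' a)] (L : C.Lifts) (Φ : C.LiftedFrameChange e')

/-- **The transformed lifts `T̃'_{ab} = ũ'_a T̃_{ab} ũ_b`** for the reframed cover.
[cite: Hartshorne2010, §7 (proof of Thm. 7.1)] -/
@[reducible] def reframe : (C.reframe e').Lifts where
  T a b := Φ.V'On a (C.U a ⊓ C.U b) inf_le_left * L.T a b * Φ.VOn b (C.U a ⊓ C.U b) inf_le_right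
  map_T a b := by
    change (Φ.V'On a (C.U a ⊓ C.U b) inf_le_left * L.T a b * Φ.VOn b (C.U a ⊓ C.U b) inf_le_right).map
      (i.app (C.U a ⊓ C.U b)).hom = (C.reframe e').trans a b (C.U a ⊓ C.U b) inf_le_left inf_le_right
    rw [Matrix.map_mul, Matrix.map_mul, Φ.map_V'On, Φ.map_VOn, L.map_T]
    exact (C.trans_reframe e' a b (C.U a ⊓ C.U b) inf_le_left inf_le_right).symm

/-- The transformed lifts over `V`: `T̃'_{ab}|_V = ũ'_a|_V T̃_{ab}|_V ũ_b|_V`. [folklore] -/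
theorem TOn_reframe (a b : ι) (V : Z₁.Opens) (ha : V ≤ C.U a) (hb : V ≤ C.U b) :
    (L.reframe Φ).TOn a b V ha hb = Φ.V'On a V ha * L.TOn a b V ha hb * Φ.VOn b V hb := by
  change (Φ.V'On a (C.U a ⊓ C.U b) inf_le_left * L.T a b * Φ.VOn b (C.U a ⊓ C.U b) inf_le_right).map
    (secRes Z₁ (le_inf ha hb)) = _
  rw [Matrix.map_mul, Matrix.map_mul, Φ.V'On_map, Φ.VOn_map]
  rfl

/-- **The defect after reframing is conjugated: `c'_{abd} = ũ'_a c_{abd} ũ_d`** (exactly, because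
the lifted frame changes are mutually inverse). [cite: Hartshorne2010, §7 (proof of Thm. 7.1)] -/
theorem defect_reframe (a b d : ι) (V : Z₁.Opens) (ha : V ≤ C.U a) (hb : V ≤ C.U b) (hd : V ≤ C.U d) :
    (L.reframe Φ).defect a b d V ha hb hd = Φ.V'On a V ha * L.defect a b d V ha hb hd * Φ.VOn d V hd := by
  rw [defect, defect, TOn_reframe, TOn_reframe, TOn_reframe, Matrix.mul_sub, Matrix.sub_mul]
  congr 1
  calc Φ.V'On a V ha * L.TOn a b V ha hb * Φ.VOn b V hb * (Φ.V'On b V hb * L.TOn b d V hb hd * Φ.VOn d V hd)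
      = Φ.V'On a V ha * L.TOn a b V ha hb * (Φ.VOn b V hb * Φ.V'On b V hb) * L.TOn b d V hb hd *
          Φ.VOn d V hd := by simp only [Matrix.mul_assoc]
    _ = Φ.V'On a V ha * (L.TOn a b V ha hb * L.TOn b d V hb hd) * Φ.VOn d V hd := by
          rw [Φ.VOn_mul_V'On, Matrix.mul_one]; simp only [Matrix.mul_assoc]

end Lifts

end FrameCover

end Literature.AlgebraicGeometry.Deformation

end
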